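import Literature.NumberTheory.Sieve.CFSemigroupTwistedPowers
import HarnessLib

/-!
# Perron–Frobenius gap for the congruence transfer operator (real cone part)

Support file (all results proved) for the named fact
`Literature.NumberTheory.Sieve.MageeOhWinter2019_uniformCounting` (`CFSemigroupCounting.lean`).
For a FIXED modulus `q` prime to `6 (b - a)` (`a ≠ b ∈ A`) we run Bowen's cone argument of
`CFSemigroupSpectralGap.lean` for the congruence transfer operator `𝓜 = 𝓜_{δ,q}` of
[MageeOhWinter2019, §3.2] acting on `SL₂(ℤ/qℤ)`-indexed families of real functions on `[0,1]`
(the real recursion `cfTwistSumR` of `CFSemigroupTwistedPowers.lean`). The positivity input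
`L_δⁿ 1 > 0` of the scalar case is replaced by the PRIMITIVITY of the twists
(`cfTwist_primitive`): after `n₀` steps every fibre sees every other fibre, so a family of cone
functions with unit AVERAGE mass acquires a uniform pointwise lower bound (`cfTwistSumR_lower`).
With the explicit eigen-data `h ⊗ 𝟙` (eigenfamily) and `Φ ↦ |Γ_q|⁻¹ Σ_ξ ∫ Φ_ξ dν` (invariant
functional, `cfFibAvg_cfTwistSumR`) Bowen's iteration then gives geometric convergence
`𝓜ⁿ Φ → avg(Φ) · h ⊗ 𝟙`, uniformly on `[0,1]`, for cone families (`cfTwistSumR_decay_cone`) and for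
Lipschitz families (`cfTwistSumR_decay_lipschitz`). This is the fixed-`q` spectral gap behind the
main term of the congruence count (no uniformity in `q` — that is [MageeOhWinter2019, Thm. 4]).

## References

* M. Magee, H. Oh, D. Winter, J. reine angew. Math. 753 (2019) 89–135, §3.2, Thm. 10. [MageeOhWinter2019]
* R. Bowen, Equilibrium states and the ergodic theory of Anosov diffeomorphisms, LNM 470 (1975), §1.C.
-/

noncomputable section

open Set MeasureTheory
open scoped MatrixGroups

namespace Literature.NumberTheory.Sieve

variable {A : Finset ℕ}

/-- The matrix of a pair is the matrix of the two-letter word. [folklore] -/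
theorem cfMat_pair (a b : ℕ) : cfMat ![a, b] = cfGen a * cfGen b := by
  rw [show (![a, b] : Fin 2 → ℕ) = Fin.append ![a] ![b] by funext i; fin_cases i <;> rfl,
    cfMat_append, cfMat_fin_one, cfMat_fin_one]
  rfl

section Gap

variable (A) (hA : ∀ a ∈ A, 1 ≤ a) (h2 : 2 ≤ A.card) (q : ℕ)
include hA

/-! ### The one-step operator and its algebra -/

omit hA in
/-- **Semigroup property of the real twisted sums:** `T_{n+1} Φ = T_1 (T_n Φ)`. [folklore] -/
theorem cfTwistSumR_succ (n : ℕ) (Φ : SL(2, ZMod q) → ℝ → ℝ) :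
    cfTwistSumR A q (n + 1) Φ = cfTwistSumR A q 1 (cfTwistSumR A q n Φ) := by
  funext ξ x
  simp only [cfTwistSumR]

omit hA in
/-- `T_{m+n} Φ = T_m (T_n Φ)`. [folklore] -/
theorem cfTwistSumR_add (m n : ℕ) (Φ : SL(2, ZMod q) → ℝ → ℝ) :
    cfTwistSumR A q (m + n) Φ = cfTwistSumR A q m (cfTwistSumR A q n Φ) := by
  induction m with
  | zero => simp [cfTwistSumR]
  | succ m ih =>
      rw [show m + 1 + n = (m + n) + 1 by ring, cfTwistSumR_succ A q, ih, ← cfTwistSumR_succ A q]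

omit hA in
/-- **Linearity:** `T_n (Φ + c Ψ) = T_n Φ + c T_n Ψ` pointwise. [folklore] -/
theorem cfTwistSumR_add_smul (c : ℝ) :
    ∀ (n : ℕ) (Φ Ψ : SL(2, ZMod q) → ℝ → ℝ) (ξ : SL(2, ZMod q)) (x : ℝ),
      cfTwistSumR A q n (fun η y => Φ η y + c * Ψ η y) ξ x = cfTwistSumR A q n Φ ξ x + c * cfTwistSumR A q n Ψ ξ x
  | 0, Φ, Ψ, ξ, x => by simp [cfTwistSumR]
  | n + 1, Φ, Ψ, ξ, x => by
      simp only [cfTwistSumR, cfTwistSumR_add_smul c n, mul_add, Finset.sum_add_distrib, Finset.mul_sum]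
      congr 1
      exact Finset.sum_congr rfl fun a _ => Finset.sum_congr rfl fun b _ => by ring

omit hA in
/-- Pointwise congruence on `[0,1]` propagates through `T_n`. [folklore] -/
theorem cfTwistSumR_congr {Φ Ψ : SL(2, ZMod q) → ℝ → ℝ} (hA' : ∀ a ∈ A, 1 ≤ a)
    (h : ∀ η, ∀ y ∈ Icc (0 : ℝ) 1, Φ η y = Ψ η y) :
    ∀ (n : ℕ) (ξ : SL(2, ZMod q)) {x : ℝ}, x ∈ Icc (0 : ℝ) 1 → cfTwistSumR A q n Φ ξ x = cfTwistSumR A q n Ψ ξ x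
  | 0, ξ, x, hx => h ξ x hx
  | n + 1, ξ, x, hx => by
      simp only [cfTwistSumR]
      exact Finset.sum_congr rfl fun a _ => Finset.sum_congr rfl fun b _ => by
        rw [cfTwistSumR_congr hA' h n _ (cfMoeb_pair_mem (hA' a a.2) (hA' b b.2) hx)]

/-- **`ξ`-constant families:** `T_n (ξ ↦ g) ξ x = (L_δ^{2n} g)(x)` on `[0,1]`. [cite: MageeOhWinter2019, §3.2] -/
theorem cfTwistSumR_const :
    ∀ (n : ℕ) (g : ℝ → ℝ) (ξ : SL(2, ZMod q)) {x : ℝ}, x ∈ Icc (0 : ℝ) 1 →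
      cfTwistSumR A q n (fun _ => g) ξ x = (cfTransfer A (cfDimension A))^[2 * n] g x
  | 0, g, ξ, x, _ => by simp [cfTwistSumR]
  | n + 1, g, ξ, x, hx => by
      rw [cfTwistSumR, show 2 * (n + 1) = (2 * n + 1) + 1 by ring, Function.iterate_succ_apply',
        Function.iterate_succ_apply', cfTransfer, Finset.sum_comm, ← Finset.sum_attach A]
      refine Finset.sum_congr rfl fun b _ => ?_
      rw [cfTransfer, Finset.mul_sum, ← Finset.sum_attach A]
      refine Finset.sum_congr rfl fun a _ => ?_
      have hxb : 0 < cfDenom (cfGen (b : ℕ)) x := by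
        rw [cfDenom_cfGen]; have hb1 : (1 : ℝ) ≤ ((b : ℕ) : ℝ) := by exact_mod_cast hA b b.2
        linarith [hx.1]
      have hy : cfMoeb (cfGen (b : ℕ)) x ∈ Icc (0 : ℝ) 1 := by
        rw [cfMoeb_cfGen]; exact one_div_add_mem_Icc (hA b b.2) hx
      rw [cfTwistSumR_const n g _ (cfMoeb_pair_mem (hA a a.2) (hA b b.2) hx), cfWtR,
        cfDenom_mul _ _ hxb.ne', cfMoeb_mul _ _ hxb.ne' (by
          rw [cfDenom_cfGen]; have ha1 : (1 : ℝ) ≤ ((a : ℕ) : ℝ) := by exact_mod_cast hA a a.2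
          linarith [hy.1]),
        cfDenom_cfGen, cfDenom_cfGen, cfMoeb_cfGen, cfMoeb_cfGen, mul_pow,
        Real.mul_rpow (sq_nonneg _) (sq_nonneg _)]
      ring

include h2 in
/-- **The eigenfamily:** `T_n (h ⊗ 𝟙) = h ⊗ 𝟙` on `[0,1]` (`L_δ h = h`). [cite: MageeOhWinter2019, Thm. 10] -/
theorem cfTwistSumR_cfHδ (n : ℕ) (ξ : SL(2, ZMod q)) {x : ℝ} (hx : x ∈ Icc (0 : ℝ) 1) :
    cfTwistSumR A q n (fun _ => cfHδ A hA h2) ξ x = cfHδ A hA h2 x := by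
  rw [cfTwistSumR_const A hA q n _ ξ hx]
  have key : ∀ (m : ℕ) {y : ℝ}, y ∈ Icc (0 : ℝ) 1 → (cfTransfer A (cfDimension A))^[m] (cfHδ A hA h2) y = cfHδ A hA h2 y := by
    intro m
    induction m with
    | zero => intro y _; rfl
    | succ m ih =>
        intro y hy
        rw [Function.iterate_succ_apply,
          cfTransfer_iterate_congr hA _ m (g := cfTransfer A (cfDimension A) (cfHδ A hA h2)) (g' := cfHδ A hA h2)
            (fun z hz => cfHδ_eigen A hA h2 hz) hy]
        exact ih hy
  exact key _ hx

/-! ### The fibre sum and the invariant average -/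

/-- **The fibre sum is transported by `L_δ²`:** `Σ_ξ T_1 Φ ξ x = (L_δ² (Σ_ξ Φ_ξ))(x)` on `[0,1]`.
[cite: MageeOhWinter2019, §3.2] -/
theorem sum_cfTwistSumR_one [NeZero q] (Φ : SL(2, ZMod q) → ℝ → ℝ) {x : ℝ} (hx : x ∈ Icc (0 : ℝ) 1) :
    ∑ ξ, cfTwistSumR A q 1 Φ ξ x = (cfTransfer A (cfDimension A))^[2] (fun y => ∑ ξ, Φ ξ y) x := by
  have h1 : ∑ ξ, cfTwistSumR A q 1 Φ ξ x = cfTwistSumR A q 1 (fun _ y => ∑ ξ, Φ ξ y) 1 x := by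
    simp only [cfTwistSumR, Finset.mul_sum]
    rw [Finset.sum_comm]
    refine Finset.sum_congr rfl fun a _ => ?_
    rw [Finset.sum_comm]
    refine Finset.sum_congr rfl fun b _ => ?_
    exact Fintype.sum_equiv (Equiv.mulRight (cfSigma q (a : ℕ) (b : ℕ))) _ _ fun ξ => rfl
  rw [h1, cfTwistSumR_const A hA q 1 _ 1 hx]

variable {q}

/-- The invariant functional: the AVERAGE over the fibres of the `ν`-masses. [cite: MageeOhWinter2019, §3.2] -/
def cfFibAvg [NeZero q] (h2 : 2 ≤ A.card) (Φ : SL(2, ZMod q) → ℝ → ℝ) : ℝ :=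
  (Fintype.card (SL(2, ZMod q)) : ℝ)⁻¹ * ∑ ξ, cfInt (cfNuδ A hA h2) (Φ ξ)

/-- Continuity of `T_1 Φ` fibres on `[0,1]` for continuous fibres. [folklore] -/
theorem continuousOn_cfTwistSumR_one {Φ : SL(2, ZMod q) → ℝ → ℝ} (hΦ : ∀ ξ, ContinuousOn (Φ ξ) (Icc 0 1))
    (ξ : SL(2, ZMod q)) : ContinuousOn (cfTwistSumR A q 1 Φ ξ) (Icc 0 1) := by
  simp only [cfTwistSumR]
  refine continuousOn_finsetSum _ fun a _ => continuousOn_finsetSum _ fun b _ => ?_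
  have ha1 : (1 : ℝ) ≤ ((a : ℕ) : ℝ) := by exact_mod_cast hA a a.2
  have hb1 : (1 : ℝ) ≤ ((b : ℕ) : ℝ) := by exact_mod_cast hA b b.2
  -- weight and branch are continuous on `[0,1]` (denominators `≥ 1`)
  have hden : ∀ x ∈ Icc (0 : ℝ) 1, cfDenom (cfGen (a : ℕ) * cfGen (b : ℕ)) x =
      (1 / (x + (b : ℕ)) + (a : ℕ)) * (x + (b : ℕ)) := fun x hx => by
    have hxb : cfDenom (cfGen (b : ℕ)) x ≠ 0 := by rw [cfDenom_cfGen]; linarith [hx.1]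
    rw [cfDenom_mul _ _ hxb, cfDenom_cfGen, cfDenom_cfGen, cfMoeb_cfGen, mul_comm]
  have hmo : ∀ x ∈ Icc (0 : ℝ) 1, cfMoeb (cfGen (a : ℕ) * cfGen (b : ℕ)) x = 1 / (1 / (x + (b : ℕ)) + (a : ℕ)) :=
    fun x hx => by
    have hxb : cfDenom (cfGen (b : ℕ)) x ≠ 0 := by rw [cfDenom_cfGen]; linarith [hx.1]
    have hy : 0 ≤ 1 / (x + (b : ℕ)) := by have := hx.1; positivity
    rw [cfMoeb_mul _ _ hxb (by rw [cfDenom_cfGen, cfMoeb_cfGen]; linarith), cfMoeb_cfGen, cfMoeb_cfGen]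
  have hc1 : ContinuousOn (fun x : ℝ => 1 / (x + (b : ℕ))) (Icc 0 1) :=
    continuousOn_const.div (continuousOn_id.add continuousOn_const) fun x hx =>
      ne_of_gt (show (0 : ℝ) < x + ((b : ℕ) : ℝ) by linarith [hx.1])
  have hc2 : ContinuousOn (fun x : ℝ => 1 / (x + (b : ℕ)) + (a : ℕ)) (Icc 0 1) := hc1.add continuousOn_const
  have hc2pos : ∀ x ∈ Icc (0 : ℝ) 1, 0 < 1 / (x + (b : ℕ)) + (a : ℕ) := fun x hx => by
    have : 0 ≤ 1 / (x + (b : ℕ)) := by have := hx.1; positivity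
    linarith
  have hwt : ContinuousOn (fun x => cfWtR A (a : ℕ) (b : ℕ) x) (Icc 0 1) := by
    have hc : ContinuousOn (fun x : ℝ => (((1 / (x + (b : ℕ)) + (a : ℕ)) * (x + (b : ℕ))) ^ 2) ^ (-cfDimension A)) (Icc 0 1) :=
      ((hc2.mul (continuousOn_id.add continuousOn_const)).pow 2).rpow_const fun x hx =>
        Or.inl (pow_ne_zero _ (mul_pos (hc2pos x hx) (show (0 : ℝ) < x + ((b : ℕ) : ℝ) by linarith [hx.1])).ne')
    exact hc.congr fun x hx => by simp only [cfWtR, hden x hx]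
  have hbr : ContinuousOn (fun x => cfTwistSumR A q 0 Φ (ξ * cfSigma q (a : ℕ) (b : ℕ)) (cfMoeb (cfGen (a : ℕ) * cfGen (b : ℕ)) x))
      (Icc 0 1) := by
    simp only [cfTwistSumR]
    have hc3 : ContinuousOn (fun x : ℝ => 1 / (1 / (x + (b : ℕ)) + (a : ℕ))) (Icc 0 1) :=
      continuousOn_const.div hc2 fun x hx => (hc2pos x hx).ne'
    refine ((hΦ (ξ * cfSigma q (a : ℕ) (b : ℕ))).comp hc3 fun x hx => ?_).congr fun x hx => by
      simp only [Function.comp, hmo x hx]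
    rw [← hmo x hx]; exact cfMoeb_pair_mem (hA a a.2) (hA b b.2) hx
  exact hwt.mul hbr

/-- Continuity of all `T_n Φ` fibres. [folklore] -/
theorem continuousOn_cfTwistSumR {Φ : SL(2, ZMod q) → ℝ → ℝ} (hΦ : ∀ ξ, ContinuousOn (Φ ξ) (Icc 0 1)) :
    ∀ (n : ℕ) (ξ : SL(2, ZMod q)), ContinuousOn (cfTwistSumR A q n Φ ξ) (Icc 0 1)
  | 0, ξ => hΦ ξ
  | n + 1, ξ => by
      rw [cfTwistSumR_succ A q]
      exact continuousOn_cfTwistSumR_one A hA (continuousOn_cfTwistSumR hΦ n) ξ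

include h2 in
/-- **Invariance of the average:** `avg(T_n Φ) = avg(Φ)` for continuous fibres. [cite: MageeOhWinter2019, §3.2] -/
theorem cfFibAvg_cfTwistSumR [NeZero q] {Φ : SL(2, ZMod q) → ℝ → ℝ} (hΦ : ∀ ξ, ContinuousOn (Φ ξ) (Icc 0 1)) :
    ∀ n : ℕ, cfFibAvg A hA h2 (cfTwistSumR A q n Φ) = cfFibAvg A hA h2 Φ
  | 0 => rfl
  | n + 1 => by
      rw [← cfFibAvg_cfTwistSumR hΦ n, cfTwistSumR_succ A q]
      set Ψ := cfTwistSumR A q n Φ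
      have hΨ : ∀ ξ, ContinuousOn (Ψ ξ) (Icc 0 1) := continuousOn_cfTwistSumR A hA hΦ n
      unfold cfFibAvg
      congr 1
      -- `Σ_ξ ∫ (T_1 Ψ)_ξ dν = ∫ Σ_ξ (T_1 Ψ)_ξ dν = ∫ L_δ² (Σ_ξ Ψ_ξ) dν = ∫ Σ_ξ Ψ_ξ dν = Σ_ξ ∫ Ψ_ξ dν`
      have hsum1 : ∑ ξ, cfInt (cfNuδ A hA h2) (cfTwistSumR A q 1 Ψ ξ) =
          cfInt (cfNuδ A hA h2) (fun y => ∑ ξ, cfTwistSumR A q 1 Ψ ξ y) := by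
        unfold cfInt
        rw [integral_finsetSum _ fun ξ _ => cfIntegrable _ (continuousOn_cfTwistSumR_one A hA hΨ ξ)]
      have hsum2 : ∑ ξ, cfInt (cfNuδ A hA h2) (Ψ ξ) = cfInt (cfNuδ A hA h2) (fun y => ∑ ξ, Ψ ξ y) := by
        unfold cfInt
        rw [integral_finsetSum _ fun ξ _ => cfIntegrable _ (hΨ ξ)]
      rw [hsum1, hsum2, cfInt_congr (cfNuδ A hA h2) (fun y hy => sum_cfTwistSumR_one A hA q Ψ hy),
        cfInt_cfTransfer_iterate hA (cfNuδ A hA h2) (cfNuδ_eigen A hA h2) (continuousOn_finsetSum _ fun ξ _ => hΨ ξ) 2,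
        cfEig_cfDimension hA h2, one_pow, one_mul]

/-! ### The cone step -/

include h2 in
/-- **Positivity:** `T_n Φ ξ x > 0` for positive fibres. [folklore] -/
theorem cfTwistSumR_pos {Φ : SL(2, ZMod q) → ℝ → ℝ} (hΦ : ∀ η, ∀ y ∈ Icc (0 : ℝ) 1, 0 < Φ η y) :
    ∀ (n : ℕ) (ξ : SL(2, ZMod q)) {x : ℝ}, x ∈ Icc (0 : ℝ) 1 → 0 < cfTwistSumR A q n Φ ξ x
  | 0, ξ, x, hx => hΦ ξ x hx
  | n + 1, ξ, x, hx => by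
      obtain ⟨a, ha⟩ := nonempty_of_two_le_card h2
      simp only [cfTwistSumR]
      have hnn : ∀ a' ∈ A.attach, ∀ b' ∈ A.attach, 0 < cfWtR A (a' : ℕ) (b' : ℕ) x *
          cfTwistSumR A q n Φ (ξ * cfSigma q (a' : ℕ) (b' : ℕ)) (cfMoeb (cfGen (a' : ℕ) * cfGen (b' : ℕ)) x) :=
        fun a' _ b' _ => mul_pos (lt_of_lt_of_le (Real.rpow_pos_of_pos (by positivity) _)
          (le_cfWtR A hA h2 (B := A.sup id) (fun c hc => Finset.le_sup (f := id) hc) a'.2 b'.2 hx))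
          (cfTwistSumR_pos hΦ n _ (cfMoeb_pair_mem (hA a' a'.2) (hA b' b'.2) hx))
      exact Finset.sum_pos (fun a' ha' => Finset.sum_pos (fun b' hb' => hnn a' ha' b' hb') ⟨⟨a, ha⟩, Finset.mem_attach _ _⟩)
        ⟨⟨a, ha⟩, Finset.mem_attach _ _⟩

include h2 in
/-- **The cone step** (vector version of the strict cone invariance of `L_δ²`): if every fibre of `Φ`
lies in `C_K` (`K ≥ 4δ`) then every fibre of `T_1 Φ` lies in `C_{2δ + K/2} ⊆ C_K`.
[cite: MageeOhWinter2019, Thm. 10] -/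
theorem cfCone_cfTwistSumR_one {K : ℝ} (hK : 4 * cfDimension A ≤ K) {Φ : SL(2, ZMod q) → ℝ → ℝ}
    (hΦ : ∀ η, CfCone K (Φ η)) (ξ : SL(2, ZMod q)) :
    CfCone (2 * cfDimension A + K / 2) (cfTwistSumR A q 1 Φ ξ) := by
  have hδ := (cfDimension_pos hA h2).le
  have hK0 : 0 ≤ K := by linarith
  refine ⟨fun y hy => cfTwistSumR_pos A hA h2 (fun η y hy => (hΦ η).pos y hy) 1 ξ hy, fun x hx y hy => ?_⟩
  simp only [cfTwistSumR, Finset.mul_sum]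
  refine Finset.sum_le_sum fun a _ => Finset.sum_le_sum fun b _ => ?_
  set η := ξ * cfSigma q (a : ℕ) (b : ℕ)
  have hw : ∀ i, 1 ≤ (![(a : ℕ), (b : ℕ)] : Fin 2 → ℕ) i := by
    intro i; fin_cases i
    · exact hA a a.2
    · exact hA b b.2
  have hMx := cfMoeb_cfMat_mem hw hx
  have hMy := cfMoeb_cfMat_mem hw hy
  have hwt := cfDenom_rpow_le_exp_mul hw hδ hx hy
  have hcontr := abs_cfMoeb_sub_le_geom hw hx hy
  rw [cfMat_pair] at hMx hMy hwt hcontr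
  have hfM := (hΦ η).le _ hMx _ hMy
  have hexpf : Real.exp (K * |cfMoeb (cfGen (a : ℕ) * cfGen (b : ℕ)) x - cfMoeb (cfGen (a : ℕ) * cfGen (b : ℕ)) y|) ≤
      Real.exp (K * ((1 / 2 : ℝ) ^ (2 - 1) * |x - y|)) :=
    Real.exp_le_exp.2 (mul_le_mul_of_nonneg_left hcontr hK0)
  have hfy : 0 < Φ η (cfMoeb (cfGen (a : ℕ) * cfGen (b : ℕ)) y) := (hΦ η).pos _ hMy
  have hfbound : Φ η (cfMoeb (cfGen (a : ℕ) * cfGen (b : ℕ)) x) ≤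
      Real.exp (K * ((1 / 2 : ℝ) ^ (2 - 1) * |x - y|)) * Φ η (cfMoeb (cfGen (a : ℕ) * cfGen (b : ℕ)) y) :=
    hfM.trans (mul_le_mul_of_nonneg_right hexpf hfy.le)
  have hsplit : Real.exp ((2 * cfDimension A + K / 2) * |x - y|) =
      Real.exp (2 * cfDimension A * |x - y|) * Real.exp (K * ((1 / 2 : ℝ) ^ (2 - 1) * |x - y|)) := by
    rw [← Real.exp_add]; congr 1; ring
  unfold cfWtR
  calc ((cfDenom (cfGen (a : ℕ) * cfGen (b : ℕ)) x) ^ 2) ^ (-cfDimension A) * Φ η (cfMoeb (cfGen (a : ℕ) * cfGen (b : ℕ)) x)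
      ≤ (Real.exp (2 * cfDimension A * |x - y|) * ((cfDenom (cfGen (a : ℕ) * cfGen (b : ℕ)) y) ^ 2) ^ (-cfDimension A)) *
          (Real.exp (K * ((1 / 2 : ℝ) ^ (2 - 1) * |x - y|)) * Φ η (cfMoeb (cfGen (a : ℕ) * cfGen (b : ℕ)) y)) :=
        mul_le_mul hwt hfbound ((hΦ η).pos _ hMx).le (mul_nonneg (Real.exp_pos _).le (Real.rpow_nonneg (sq_nonneg _) _))
    _ = Real.exp ((2 * cfDimension A + K / 2) * |x - y|) *
          (((cfDenom (cfGen (a : ℕ) * cfGen (b : ℕ)) y) ^ 2) ^ (-cfDimension A) * Φ η (cfMoeb (cfGen (a : ℕ) * cfGen (b : ℕ)) y)) := by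
        rw [hsplit]; ring

include h2 in
/-- **Iterated cone invariance:** all fibres of `T_n Φ` stay in `C_K` (`K ≥ 4δ`), and lie in
`C_{2δ + K/2}` as soon as `n ≥ 1`. [cite: MageeOhWinter2019, Thm. 10] -/
theorem cfCone_cfTwistSumR {K : ℝ} (hK : 4 * cfDimension A ≤ K) {Φ : SL(2, ZMod q) → ℝ → ℝ}
    (hΦ : ∀ η, CfCone K (Φ η)) : ∀ (n : ℕ) (ξ : SL(2, ZMod q)), CfCone K (cfTwistSumR A q n Φ ξ)
  | 0, ξ => hΦ ξ
  | n + 1, ξ => by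
      rw [cfTwistSumR_succ A q]
      have hδ := (cfDimension_pos hA h2).le
      exact (cfCone_cfTwistSumR_one A hA h2 hK (cfCone_cfTwistSumR hK hΦ n) ξ).mono (by linarith)

include h2 in
/-- After at least one step the fibres lie in the smaller cone `C_{2δ + K/2}`. [cite: MageeOhWinter2019, Thm. 10] -/
theorem cfCone_cfTwistSumR_succ {K : ℝ} (hK : 4 * cfDimension A ≤ K) {Φ : SL(2, ZMod q) → ℝ → ℝ}
    (hΦ : ∀ η, CfCone K (Φ η)) (n : ℕ) (ξ : SL(2, ZMod q)) :
    CfCone (2 * cfDimension A + K / 2) (cfTwistSumR A q (n + 1) Φ ξ) := by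
  rw [cfTwistSumR_succ A q]
  exact cfCone_cfTwistSumR_one A hA h2 hK (cfCone_cfTwistSumR A hA h2 hK hΦ n) ξ

/-! ### The Doeblin lower bound from primitivity -/

/-- The lower constant after `N` steps: `((B+1)^4)^{-δ N} e^{-K}` (`B = max A`). [folklore] -/
def cfTwLow (K : ℝ) (N : ℕ) : ℝ := (((((A.sup id : ℕ) : ℝ) + 1) ^ 4) ^ (-cfDimension A)) ^ N * Real.exp (-K)

omit hA in
/-- The lower constant is positive. [folklore] -/
theorem cfTwLow_pos (K : ℝ) (N : ℕ) : 0 < cfTwLow A K N := by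
  unfold cfTwLow
  exact mul_pos (pow_pos (Real.rpow_pos_of_pos (by positivity) _) _) (Real.exp_pos _)

include h2 in
/-- The lower constant is at most `e^{-K}`. [folklore] -/
theorem cfTwLow_le (K : ℝ) (N : ℕ) : cfTwLow A K N ≤ Real.exp (-K) := by
  unfold cfTwLow
  have hδ := (cfDimension_pos hA h2).le
  have h1 : (((((A.sup id : ℕ) : ℝ) + 1) ^ 4) ^ (-cfDimension A)) ≤ 1 :=
    Real.rpow_le_one_of_one_le_of_nonpos (one_le_pow₀ (by
      have : (0 : ℝ) ≤ ((A.sup id : ℕ) : ℝ) := by positivity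
      linarith)) (by linarith)
  have h2' : (((((A.sup id : ℕ) : ℝ) + 1) ^ 4) ^ (-cfDimension A)) ^ N ≤ 1 :=
    pow_le_one₀ (Real.rpow_nonneg (by positivity) _) h1
  exact (mul_le_mul_of_nonneg_right h2' (Real.exp_pos _).le).trans (by rw [one_mul])

include h2 in
/-- **The Doeblin lower bound:** if the twists are primitive with threshold `n₀`, every fibre of `Φ`
lies in `C_K` (`K ≥ 0`) and the average mass is `1`, then for `N ≥ n₀` every fibre of `T_N Φ` is
bounded below by `cfTwLow K N > 0` on `[0,1]` (follow a twist-word of length `N` from `ξ` to a fibre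
of mass `≥ 1`). [cite: MageeOhWinter2019, §3.2] -/
theorem cfTwistSumR_lower [NeZero q] {n₀ : ℕ}
    (hprim : ∀ n ≥ n₀, ∀ ξ η : SL(2, ZMod q), ∃ w : List (A × A), w.length = n ∧ ξ * cfSigmaWord A q w = η)
    {K : ℝ} (hK : 0 ≤ K) {Φ : SL(2, ZMod q) → ℝ → ℝ} (hΦ : ∀ η, CfCone K (Φ η)) (havg : cfFibAvg A hA h2 Φ = 1)
    {N : ℕ} (hN : n₀ ≤ N) (ξ : SL(2, ZMod q)) {x : ℝ} (hx : x ∈ Icc (0 : ℝ) 1) :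
    cfTwLow A K N ≤ cfTwistSumR A q N Φ ξ x := by
  -- a fibre of mass `≥ 1`
  obtain ⟨η, -, hη⟩ : ∃ η ∈ (Finset.univ : Finset (SL(2, ZMod q))), (1 : ℝ) ≤ cfInt (cfNuδ A hA h2) (Φ η) := by
    refine Finset.exists_le_of_sum_le Finset.univ_nonempty ?_
    have hcard : (0 : ℝ) < Fintype.card (SL(2, ZMod q)) := by exact_mod_cast Fintype.card_pos
    have h := havg
    unfold cfFibAvg at h
    rw [inv_mul_eq_iff_eq_mul₀ hcard.ne'] at h
    rw [Finset.sum_const, Finset.card_univ, nsmul_eq_mul, h, mul_one]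
  -- a word of length `N` from `ξ` to `η`
  obtain ⟨w, hwlen, hwσ⟩ := hprim N hN ξ η
  have hpath := cfTwistSumR_ge_path A hA q (fun η y hy => ((hΦ η).pos y hy).le) w ξ hx
  rw [hwlen, hwσ] at hpath
  refine le_trans ?_ hpath
  have hpt := cfPathPoint_mem A hA w hx
  have hΦlow : Real.exp (-K) ≤ Φ η (cfPathPoint A w x) :=
    le_trans (by simpa using mul_le_mul_of_nonneg_left hη (Real.exp_pos (-K)).le)
      ((hΦ η).exp_neg_mul_cfInt_le (cfNuδ A hA h2) hK hpt)
  have hwt := le_cfPathWt A hA h2 (B := A.sup id) (fun c hc => Finset.le_sup (f := id) hc) w hx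
  rw [hwlen] at hwt
  unfold cfTwLow
  exact mul_le_mul hwt hΦlow (Real.exp_pos _).le
    ((pow_nonneg (Real.rpow_nonneg (by positivity) _) _).trans hwt)

/-! ### Bowen's iteration for the congruence operator -/

omit hA in
/-- **Scalar linearity:** `T_n (c Ψ) = c T_n Ψ`. [folklore] -/
theorem cfTwistSumR_const_mul (c : ℝ) :
    ∀ (n : ℕ) (Ψ : SL(2, ZMod q) → ℝ → ℝ) (ξ : SL(2, ZMod q)) (x : ℝ),
      cfTwistSumR A q n (fun η y => c * Ψ η y) ξ x = c * cfTwistSumR A q n Ψ ξ x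
  | 0, Ψ, ξ, x => by simp [cfTwistSumR]
  | n + 1, Ψ, ξ, x => by
      simp only [cfTwistSumR, cfTwistSumR_const_mul c n, Finset.mul_sum]
      exact Finset.sum_congr rfl fun a _ => Finset.sum_congr rfl fun b _ => by ring

omit hA in
/-- **Domination:** `|E| ≤ S` on `[0,1]` implies `|T_n E ξ x| ≤ S · T_n 𝟙 ξ x` on `[0,1]`. [folklore] -/
theorem abs_cfTwistSumR_le (hA' : ∀ a ∈ A, 1 ≤ a) {E : SL(2, ZMod q) → ℝ → ℝ} {S : ℝ}
    (hE : ∀ η, ∀ y ∈ Icc (0 : ℝ) 1, |E η y| ≤ S) :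
    ∀ (n : ℕ) (ξ : SL(2, ZMod q)) {x : ℝ}, x ∈ Icc (0 : ℝ) 1 →
      |cfTwistSumR A q n E ξ x| ≤ S * cfTwistSumR A q n (fun _ _ => 1) ξ x
  | 0, ξ, x, hx => by simpa [cfTwistSumR] using hE ξ x hx
  | n + 1, ξ, x, hx => by
      simp only [cfTwistSumR, Finset.mul_sum]
      refine (Finset.abs_sum_le_sum_abs _ _).trans (Finset.sum_le_sum fun a _ => ?_)
      refine (Finset.abs_sum_le_sum_abs _ _).trans (Finset.sum_le_sum fun b _ => ?_)
      rw [abs_mul, abs_of_nonneg (cfWtR_nonneg A _ _ _), mul_left_comm]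
      exact mul_le_mul_of_nonneg_left (abs_cfTwistSumR_le hA' hE n _ (cfMoeb_pair_mem (hA' a a.2) (hA' b b.2) hx))
        (cfWtR_nonneg A _ _ _)

/-- Bowen's small parameter for the congruence operator after `N` steps:
`η = m / (2 e^{2δ} (6δ+2) e^{4δ+2})`, `m = cfTwLow (4δ+2) N`. [folklore] -/
def cfTwEta (N : ℕ) : ℝ :=
  cfTwLow A (4 * cfDimension A + 2) N /
    (2 * Real.exp (2 * cfDimension A) * ((6 * cfDimension A + 2) * Real.exp (4 * cfDimension A + 2)))

include h2 in
/-- `0 < η ≤ 1/4`. [folklore] -/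
theorem cfTwEta_pos_le (N : ℕ) : 0 < cfTwEta A N ∧ cfTwEta A N ≤ 1 / 4 := by
  have hδ := (cfDimension_pos hA h2).le
  have hm := cfTwLow_pos A (4 * cfDimension A + 2) N
  have hmle := cfTwLow_le A hA h2 (4 * cfDimension A + 2) N
  have he1 : 1 ≤ Real.exp (2 * cfDimension A) := Real.one_le_exp (by positivity)
  have he2 : 1 ≤ Real.exp (4 * cfDimension A + 2) := Real.one_le_exp (by positivity)
  have he3 : Real.exp (-(4 * cfDimension A + 2)) ≤ 1 := Real.exp_le_one_iff.2 (by linarith)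
  have hD : 4 ≤ 2 * Real.exp (2 * cfDimension A) * ((6 * cfDimension A + 2) * Real.exp (4 * cfDimension A + 2)) := by
    nlinarith [mul_le_mul he1 he2 zero_le_one (by linarith)]
  unfold cfTwEta
  refine ⟨div_pos hm (by linarith), ?_⟩
  rw [div_le_div_iff₀ (by linarith) (by norm_num : (0 : ℝ) < 4)]
  nlinarith

/-- **Bowen's map for the congruence operator:** `B Φ = (T_N Φ - η h ⊗ 𝟙)/(1 - η)`.
[cite: MageeOhWinter2019, Thm. 10] -/
def cfTwBowen (h2 : 2 ≤ A.card) (N : ℕ) (Φ : SL(2, ZMod q) → ℝ → ℝ) : SL(2, ZMod q) → ℝ → ℝ :=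
  fun ξ y => (1 - cfTwEta A N)⁻¹ * (cfTwistSumR A q N Φ ξ y - cfTwEta A N * cfHδ A hA h2 y)

include h2 in
/-- **Linearity of the average** over a difference with the eigenfamily. [folklore] -/
theorem cfFibAvg_sub_smul_cfHδ [NeZero q] {Ψ : SL(2, ZMod q) → ℝ → ℝ} (hΨ : ∀ ξ, ContinuousOn (Ψ ξ) (Icc 0 1))
    (c t : ℝ) :
    cfFibAvg A hA h2 (fun ξ y => c * (Ψ ξ y - t * cfHδ A hA h2 y)) = c * (cfFibAvg A hA h2 Ψ - t) := by
  have hδ := (cfDimension_pos hA h2).le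
  have hh : ContinuousOn (cfHδ A hA h2) (Icc 0 1) := (cfHδ_cone A hA h2).continuousOn (by positivity)
  have hcard : (0 : ℝ) < Fintype.card (SL(2, ZMod q)) := by exact_mod_cast Fintype.card_pos
  unfold cfFibAvg
  have hterm : ∀ ξ, cfInt (cfNuδ A hA h2) (fun y => c * (Ψ ξ y - t * cfHδ A hA h2 y)) =
      c * (cfInt (cfNuδ A hA h2) (Ψ ξ) - t) := fun ξ => by
    rw [cfInt_const_mul, cfInt_sub (cfNuδ A hA h2) (g' := fun y => t * cfHδ A hA h2 y) (hΨ ξ)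
      (continuousOn_const.mul hh), cfInt_const_mul, cfInt_cfHδ, mul_one]
  simp_rw [hterm]
  rw [← Finset.mul_sum, Finset.sum_sub_distrib, Finset.sum_const, Finset.card_univ, nsmul_eq_mul]
  field_simp

include h2 in
/-- **Bowen's map preserves the normalised cone families** (`N ≥ max(n₀, 1)`): fibres in `C_{4δ+2}`
and average mass `1`. [cite: MageeOhWinter2019, Thm. 10] -/
theorem cfTwBowen_mem [NeZero q] {n₀ : ℕ}
    (hprim : ∀ n ≥ n₀, ∀ ξ η : SL(2, ZMod q), ∃ w : List (A × A), w.length = n ∧ ξ * cfSigmaWord A q w = η)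
    {N : ℕ} (hN : n₀ ≤ N) (hN1 : 1 ≤ N) {Φ : SL(2, ZMod q) → ℝ → ℝ}
    (hΦ : ∀ η, CfCone (4 * cfDimension A + 2) (Φ η)) (havg : cfFibAvg A hA h2 Φ = 1) :
    (∀ η, CfCone (4 * cfDimension A + 2) (cfTwBowen A hA h2 N Φ η)) ∧ cfFibAvg A hA h2 (cfTwBowen A hA h2 N Φ) = 1 := by
  have hδ := (cfDimension_pos hA h2).le
  set δ := cfDimension A
  have hK0 : (0 : ℝ) ≤ 4 * δ + 2 := by positivity
  have hK'0 : (0 : ℝ) ≤ 4 * δ + 1 := by positivity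
  obtain ⟨hη0, hη4⟩ := cfTwEta_pos_le A hA h2 N
  have h1η : 0 < 1 - cfTwEta A N := by linarith
  -- fibres of `T_N Φ`: smaller cone, lower bound
  have hT : ∀ ξ, CfCone (4 * δ + 1) (cfTwistSumR A q N Φ ξ) := fun ξ => by
    obtain ⟨N', rfl⟩ : ∃ N', N = N' + 1 := ⟨N - 1, by omega⟩
    have h := cfCone_cfTwistSumR_succ A hA h2 (K := 4 * δ + 2) (by linarith) hΦ N' ξ
    have e : 2 * δ + (4 * δ + 2) / 2 = 4 * δ + 1 := by ring
    rwa [e] at h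
  have hTm : ∀ ξ, ∀ y ∈ Icc (0 : ℝ) 1, cfTwLow A (4 * δ + 2) N ≤ cfTwistSumR A q N Φ ξ y :=
    fun ξ y hy => cfTwistSumR_lower A hA h2 hprim hK0 hΦ havg hN ξ hy
  have hhM : ∀ y ∈ Icc (0 : ℝ) 1, cfHδ A hA h2 y ≤ Real.exp (2 * δ) := fun y hy => cfHδ_le A hA h2 hy
  have hηR : cfTwEta A N * Real.exp (2 * δ) *
      ((4 * δ + 2 + 2 * δ) * Real.exp (4 * δ + 2) / (4 * δ + 2 - (4 * δ + 1))) ≤ cfTwLow A (4 * δ + 2) N / 2 := by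
    have e0 : (4 * δ + 2 - (4 * δ + 1) : ℝ) = 1 := by ring
    have e1 : (4 * δ + 2 + 2 * δ : ℝ) = 6 * δ + 2 := by ring
    rw [e0, div_one, e1]
    unfold cfTwEta
    have hpos : 0 < 2 * Real.exp (2 * δ) * ((6 * δ + 2) * Real.exp (4 * δ + 2)) := by positivity
    rw [div_mul_eq_mul_div, div_mul_eq_mul_div, div_le_div_iff₀ hpos two_pos]
    exact le_of_eq (by ring)
  have hsub : ∀ ξ, CfCone (4 * δ + 2) (fun y => cfTwistSumR A q N Φ ξ y - cfTwEta A N * cfHδ A hA h2 y) := fun ξ =>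
    CfCone.sub_smul hK'0 (by linarith) hδ (hT ξ) (cfHδ_cone A hA h2) (cfTwLow_pos A _ N) (hTm ξ) hhM hη0.le hηR
  refine ⟨fun ξ => (hsub ξ).smul (inv_pos.2 h1η), ?_⟩
  show cfFibAvg A hA h2 (fun ξ y => (1 - cfTwEta A N)⁻¹ * (cfTwistSumR A q N Φ ξ y - cfTwEta A N * cfHδ A hA h2 y)) = 1
  rw [cfFibAvg_sub_smul_cfHδ A hA h2 (continuousOn_cfTwistSumR A hA (fun η => (hΦ η).continuousOn hK0) N),
    cfFibAvg_cfTwistSumR A hA h2 (fun η => (hΦ η).continuousOn hK0) N, havg, inv_mul_cancel₀ h1η.ne']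

include h2 in
/-- **The Bowen iterates stay in the normalised class.** [cite: MageeOhWinter2019, Thm. 10] -/
theorem cfTwBowen_iterate_mem [NeZero q] {n₀ : ℕ}
    (hprim : ∀ n ≥ n₀, ∀ ξ η : SL(2, ZMod q), ∃ w : List (A × A), w.length = n ∧ ξ * cfSigmaWord A q w = η)
    {N : ℕ} (hN : n₀ ≤ N) (hN1 : 1 ≤ N) {Φ : SL(2, ZMod q) → ℝ → ℝ}
    (hΦ : ∀ η, CfCone (4 * cfDimension A + 2) (Φ η)) (havg : cfFibAvg A hA h2 Φ = 1) :
    ∀ k : ℕ, (∀ η, CfCone (4 * cfDimension A + 2) ((cfTwBowen A hA h2 N)^[k] Φ η)) ∧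
      cfFibAvg A hA h2 ((cfTwBowen A hA h2 N)^[k] Φ) = 1
  | 0 => ⟨hΦ, havg⟩
  | k + 1 => by
      rw [Function.iterate_succ_apply']
      obtain ⟨h1, h3⟩ := cfTwBowen_iterate_mem hprim hN hN1 hΦ havg k
      exact cfTwBowen_mem A hA h2 hprim hN hN1 h1 h3

include h2 in
/-- **Unrolling Bowen's iteration:** `T_{Nk} Φ = (1 - (1-η)^k) h ⊗ 𝟙 + (1-η)^k B^k Φ` on `[0,1]`.
[cite: MageeOhWinter2019, Thm. 10] -/
theorem cfTwBowen_unroll (N : ℕ) :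
    ∀ (k : ℕ) (Φ : SL(2, ZMod q) → ℝ → ℝ) (ξ : SL(2, ZMod q)) {x : ℝ}, x ∈ Icc (0 : ℝ) 1 →
      cfTwistSumR A q (N * k) Φ ξ x = (1 - (1 - cfTwEta A N) ^ k) * cfHδ A hA h2 x +
        (1 - cfTwEta A N) ^ k * (cfTwBowen A hA h2 N)^[k] Φ ξ x
  | 0, Φ, ξ, x, _ => by simp [cfTwistSumR]
  | k + 1, Φ, ξ, x, hx => by
      obtain ⟨hη0, hη4⟩ := cfTwEta_pos_le A hA h2 N
      have h1η : (1 - cfTwEta A N) ≠ 0 := by linarith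
      -- `T_N Φ = η h ⊗ 𝟙 + (1-η) B Φ` identically
      have hsplit : cfTwistSumR A q N Φ =
          fun η y => cfTwEta A N * cfHδ A hA h2 y + (1 - cfTwEta A N) * cfTwBowen A hA h2 N Φ η y := by
        funext η y
        simp only [cfTwBowen]
        field_simp
        ring
      rw [show N * (k + 1) = N * k + N by ring, cfTwistSumR_add A q, hsplit, cfTwistSumR_add_smul,
        cfTwistSumR_const_mul, cfTwistSumR_cfHδ A hA h2 q _ ξ hx,
        cfTwBowen_unroll N k (cfTwBowen A hA h2 N Φ) ξ hx, Function.iterate_succ_apply]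
      ring

include h2 in
/-- Fibres of a normalised cone family are bounded by `e^{4δ+2} |Γ_q|`. [folklore] -/
theorem fibre_le_of_cfFibAvg [NeZero q] {Φ : SL(2, ZMod q) → ℝ → ℝ}
    (hΦ : ∀ η, CfCone (4 * cfDimension A + 2) (Φ η)) (havg : cfFibAvg A hA h2 Φ = 1)
    (ξ : SL(2, ZMod q)) {x : ℝ} (hx : x ∈ Icc (0 : ℝ) 1) :
    Φ ξ x ≤ Real.exp (4 * cfDimension A + 2) * Fintype.card (SL(2, ZMod q)) := by
  have hδ := (cfDimension_pos hA h2).le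
  have hK0 : (0 : ℝ) ≤ 4 * cfDimension A + 2 := by positivity
  have hcard : (0 : ℝ) < Fintype.card (SL(2, ZMod q)) := by exact_mod_cast Fintype.card_pos
  have h1 := (hΦ ξ).le_exp_mul_cfInt (cfNuδ A hA h2) hK0 hx
  have hsum : ∑ η, cfInt (cfNuδ A hA h2) (Φ η) = Fintype.card (SL(2, ZMod q)) := by
    have h := havg
    unfold cfFibAvg at h
    rwa [inv_mul_eq_iff_eq_mul₀ hcard.ne', mul_one] at h
  have hle : cfInt (cfNuδ A hA h2) (Φ ξ) ≤ ∑ η, cfInt (cfNuδ A hA h2) (Φ η) :=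
    Finset.single_le_sum (f := fun η => cfInt (cfNuδ A hA h2) (Φ η))
      (fun η _ => ((hΦ η).cfInt_pos (cfNuδ A hA h2) hK0).le) (Finset.mem_univ ξ)
  rw [hsum] at hle
  exact h1.trans (mul_le_mul_of_nonneg_left hle (Real.exp_pos _).le)

include h2 in
/-- **Geometric decay on the normalised class along multiples of `N`:**
`|T_{Nk} Φ ξ x - h(x)| ≤ (1-η)^k (e^{4δ+2}|Γ_q| + e^{2δ})`. [cite: MageeOhWinter2019, Thm. 10] -/
theorem cfTwistSumR_decay_mul [NeZero q] {n₀ : ℕ}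
    (hprim : ∀ n ≥ n₀, ∀ ξ η : SL(2, ZMod q), ∃ w : List (A × A), w.length = n ∧ ξ * cfSigmaWord A q w = η)
    {N : ℕ} (hN : n₀ ≤ N) (hN1 : 1 ≤ N) {Φ : SL(2, ZMod q) → ℝ → ℝ}
    (hΦ : ∀ η, CfCone (4 * cfDimension A + 2) (Φ η)) (havg : cfFibAvg A hA h2 Φ = 1)
    (k : ℕ) (ξ : SL(2, ZMod q)) {x : ℝ} (hx : x ∈ Icc (0 : ℝ) 1) :
    |cfTwistSumR A q (N * k) Φ ξ x - cfHδ A hA h2 x| ≤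
      (1 - cfTwEta A N) ^ k * (Real.exp (4 * cfDimension A + 2) * Fintype.card (SL(2, ZMod q)) +
        Real.exp (2 * cfDimension A)) := by
  obtain ⟨hη0, hη4⟩ := cfTwEta_pos_le A hA h2 N
  obtain ⟨hBk, hBk1⟩ := cfTwBowen_iterate_mem A hA h2 hprim hN hN1 hΦ havg k
  rw [cfTwBowen_unroll A hA h2 N k Φ ξ hx]
  have e : (1 - (1 - cfTwEta A N) ^ k) * cfHδ A hA h2 x + (1 - cfTwEta A N) ^ k * (cfTwBowen A hA h2 N)^[k] Φ ξ x -
      cfHδ A hA h2 x = (1 - cfTwEta A N) ^ k * ((cfTwBowen A hA h2 N)^[k] Φ ξ x - cfHδ A hA h2 x) := by ring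
  rw [e, abs_mul, abs_of_nonneg (pow_nonneg (by linarith) _)]
  refine mul_le_mul_of_nonneg_left ?_ (pow_nonneg (by linarith) _)
  have hB := fibre_le_of_cfFibAvg A hA h2 hBk hBk1 ξ hx
  have hBpos := ((hBk ξ).pos x hx).le
  have hh := cfHδ_le A hA h2 hx
  have hhpos := (cfHδ_pos A hA h2 hx).le
  rw [abs_le]; constructor <;> linarith

/-! ### Decay for all times, all cone families, all Lipschitz families -/

omit hA in
/-- Rate conversion: `b^{⌊n/N⌋} ≤ b⁻¹ (b^{1/N})ⁿ` for `0 < b < 1`, `N ≥ 1`. [folklore] -/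
theorem pow_div_le_rpow {b : ℝ} (h0 : 0 < b) (h1 : b < 1) {N : ℕ} (hN : 1 ≤ N) (n : ℕ) :
    b ^ (n / N) ≤ b⁻¹ * (b ^ ((N : ℝ)⁻¹)) ^ n := by
  have hNpos : (0 : ℝ) < N := by exact_mod_cast hN
  have hrn : (b ^ ((N : ℝ)⁻¹)) ^ n = b ^ ((n : ℝ) / N) := by
    rw [← Real.rpow_natCast, ← Real.rpow_mul h0.le]; congr 1; field_simp
  rw [hrn, ← Real.rpow_neg_one, ← Real.rpow_add h0]
  have hk : ((n / N : ℕ) : ℝ) ≥ -1 + (n : ℝ) / N := by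
    have h := Nat.lt_div_mul_add (a := n) (Nat.pos_of_ne_zero (by omega) : 0 < N)
    have h' : (n : ℝ) < ((n / N : ℕ) : ℝ) * N + N := by exact_mod_cast h
    rw [ge_iff_le, ← sub_nonneg]
    have : (n : ℝ) / N < (n / N : ℕ) + 1 := by rw [div_lt_iff₀ hNpos]; linarith
    linarith
  rw [← Real.rpow_natCast]
  exact Real.rpow_le_rpow_of_exponent_ge h0 h1.le hk

include h2 in
/-- **Geometric decay on the normalised class, all times:**
`|T_n Φ ξ x - h(x)| ≤ C₀ (1-η)^{⌊n/N⌋}`, `C₀ = 4^δ (e^{4δ+2}|Γ_q| + e^{2δ})`. [cite: MageeOhWinter2019, Thm. 10] -/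
theorem cfTwistSumR_decay_normalised [NeZero q] {n₀ : ℕ}
    (hprim : ∀ n ≥ n₀, ∀ ξ η : SL(2, ZMod q), ∃ w : List (A × A), w.length = n ∧ ξ * cfSigmaWord A q w = η)
    {N : ℕ} (hN : n₀ ≤ N) (hN1 : 1 ≤ N) {Φ : SL(2, ZMod q) → ℝ → ℝ}
    (hΦ : ∀ η, CfCone (4 * cfDimension A + 2) (Φ η)) (havg : cfFibAvg A hA h2 Φ = 1)
    (n : ℕ) (ξ : SL(2, ZMod q)) {x : ℝ} (hx : x ∈ Icc (0 : ℝ) 1) :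
    |cfTwistSumR A q n Φ ξ x - cfHδ A hA h2 x| ≤
      (4 : ℝ) ^ cfDimension A * (Real.exp (4 * cfDimension A + 2) * Fintype.card (SL(2, ZMod q)) +
        Real.exp (2 * cfDimension A)) * (1 - cfTwEta A N) ^ (n / N) := by
  set k := n / N
  set r := n % N
  set C₁ := Real.exp (4 * cfDimension A + 2) * Fintype.card (SL(2, ZMod q)) + Real.exp (2 * cfDimension A)
  set Ψ := cfTwistSumR A q (N * k) Φ with hΨ
  set E : SL(2, ZMod q) → ℝ → ℝ := fun η y => Ψ η y - cfHδ A hA h2 y with hE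
  have hEb : ∀ η, ∀ y ∈ Icc (0 : ℝ) 1, |E η y| ≤ (1 - cfTwEta A N) ^ k * C₁ := fun η y hy =>
    cfTwistSumR_decay_mul A hA h2 hprim hN hN1 hΦ havg k η hy
  have hn : n = r + N * k := (Nat.mod_add_div n N).symm
  have hΨsplit : Ψ = fun η y => cfHδ A hA h2 y + 1 * E η y := by funext η y; simp [hE]
  rw [hn, cfTwistSumR_add A q, ← hΨ, hΨsplit, cfTwistSumR_add_smul, one_mul, cfTwistSumR_cfHδ A hA h2 q r ξ hx,
    add_sub_cancel_left]
  have h1 := abs_cfTwistSumR_le A hA hEb r ξ hx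
  have h4 := cfTwistSumR_const_one_le A hA q h2 r ξ hx
  obtain ⟨hη0, hη4⟩ := cfTwEta_pos_le A hA h2 N
  have hC₁ : 0 ≤ C₁ := by positivity
  have hpk : 0 ≤ (1 - cfTwEta A N) ^ k := pow_nonneg (by linarith) _
  calc |cfTwistSumR A q r E ξ x| ≤ (1 - cfTwEta A N) ^ k * C₁ * cfTwistSumR A q r (fun _ _ => 1) ξ x := h1
    _ ≤ (1 - cfTwEta A N) ^ k * C₁ * (4 : ℝ) ^ cfDimension A :=
        mul_le_mul_of_nonneg_left h4 (mul_nonneg hpk hC₁)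
    _ = (4 : ℝ) ^ cfDimension A * C₁ * (1 - cfTwEta A N) ^ k := by ring

include h2 in
/-- **Linearity of the average.** [folklore] -/
theorem cfFibAvg_add_smul [NeZero q] {Φ Ψ : SL(2, ZMod q) → ℝ → ℝ} (hΦ : ∀ ξ, ContinuousOn (Φ ξ) (Icc 0 1))
    (hΨ : ∀ ξ, ContinuousOn (Ψ ξ) (Icc 0 1)) (c : ℝ) :
    cfFibAvg A hA h2 (fun ξ y => Φ ξ y + c * Ψ ξ y) = cfFibAvg A hA h2 Φ + c * cfFibAvg A hA h2 Ψ := by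
  unfold cfFibAvg
  have hterm : ∀ ξ, cfInt (cfNuδ A hA h2) (fun y => Φ ξ y + c * Ψ ξ y) =
      cfInt (cfNuδ A hA h2) (Φ ξ) + c * cfInt (cfNuδ A hA h2) (Ψ ξ) := fun ξ => by
    rw [cfInt_add (cfNuδ A hA h2) (g' := fun y => c * Ψ ξ y) (hΦ ξ) (continuousOn_const.mul (hΨ ξ)), cfInt_const_mul]
  simp_rw [hterm]
  rw [Finset.sum_add_distrib, ← Finset.mul_sum, mul_add, mul_left_comm]

include h2 in
/-- The average of the constant family `𝟙` is `1`. [folklore] -/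
theorem cfFibAvg_one [NeZero q] : cfFibAvg A hA h2 (fun (_ : SL(2, ZMod q)) (_ : ℝ) => (1 : ℝ)) = 1 := by
  unfold cfFibAvg
  have hcard : (0 : ℝ) < Fintype.card (SL(2, ZMod q)) := by exact_mod_cast Fintype.card_pos
  simp_rw [cfInt_const]
  rw [Finset.sum_const, Finset.card_univ, nsmul_eq_mul, mul_one, inv_mul_cancel₀ hcard.ne']

include h2 in
/-- **Geometric decay for cone families** (any positive average):
`|T_n Φ ξ x - avg(Φ) h(x)| ≤ avg(Φ) C₀ (1-η)^{⌊n/N⌋}`. [cite: MageeOhWinter2019, Thm. 10] -/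
theorem cfTwistSumR_decay_cone [NeZero q] {n₀ : ℕ}
    (hprim : ∀ n ≥ n₀, ∀ ξ η : SL(2, ZMod q), ∃ w : List (A × A), w.length = n ∧ ξ * cfSigmaWord A q w = η)
    {N : ℕ} (hN : n₀ ≤ N) (hN1 : 1 ≤ N) {Φ : SL(2, ZMod q) → ℝ → ℝ}
    (hΦ : ∀ η, CfCone (4 * cfDimension A + 2) (Φ η)) (n : ℕ) (ξ : SL(2, ZMod q)) {x : ℝ} (hx : x ∈ Icc (0 : ℝ) 1) :
    |cfTwistSumR A q n Φ ξ x - cfFibAvg A hA h2 Φ * cfHδ A hA h2 x| ≤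
      cfFibAvg A hA h2 Φ * ((4 : ℝ) ^ cfDimension A * (Real.exp (4 * cfDimension A + 2) * Fintype.card (SL(2, ZMod q)) +
        Real.exp (2 * cfDimension A)) * (1 - cfTwEta A N) ^ (n / N)) := by
  have hδ := (cfDimension_pos hA h2).le
  have hK0 : (0 : ℝ) ≤ 4 * cfDimension A + 2 := by positivity
  have hcard : (0 : ℝ) < Fintype.card (SL(2, ZMod q)) := by exact_mod_cast Fintype.card_pos
  set a := cfFibAvg A hA h2 Φ with ha
  have hapos : 0 < a := by
    unfold cfFibAvg at ha
    rw [ha]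
    exact mul_pos (inv_pos.2 hcard) (Finset.sum_pos (fun η _ => (hΦ η).cfInt_pos (cfNuδ A hA h2) hK0) Finset.univ_nonempty)
  set Φ' : SL(2, ZMod q) → ℝ → ℝ := fun η y => a⁻¹ * Φ η y with hΦ'
  have hΦ'c : ∀ η, CfCone (4 * cfDimension A + 2) (Φ' η) := fun η => (hΦ η).smul (inv_pos.2 hapos)
  have hΦ'1 : cfFibAvg A hA h2 Φ' = 1 := by
    have h := cfFibAvg_add_smul A hA h2 (Φ := fun _ _ => (0 : ℝ)) (Ψ := Φ) (fun _ => continuousOn_const)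
      (fun η => (hΦ η).continuousOn hK0) a⁻¹
    simp only [zero_add] at h
    rw [hΦ', h]
    have h0 : cfFibAvg A hA h2 (fun (_ : SL(2, ZMod q)) (_ : ℝ) => (0 : ℝ)) = 0 := by
      unfold cfFibAvg; simp [cfInt_const]
    rw [h0, zero_add, ← ha, inv_mul_cancel₀ hapos.ne']
  have hdec := cfTwistSumR_decay_normalised A hA h2 hprim hN hN1 hΦ'c hΦ'1 n ξ hx
  have hT : cfTwistSumR A q n Φ ξ x = a * cfTwistSumR A q n Φ' ξ x := by
    rw [hΦ', cfTwistSumR_const_mul, ← mul_assoc, mul_inv_cancel₀ hapos.ne', one_mul]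
  rw [hT, ← mul_sub, abs_mul, abs_of_pos hapos]
  exact mul_le_mul_of_nonneg_left hdec hapos.le

include h2 in
/-- **Geometric decay for Lipschitz families** (the fixed-`q` spectral gap, real form): for real
fibres with `|Φ_ξ| ≤ M` and `Lip(Φ_ξ) ≤ L` on `[0,1]`,
`|T_n Φ ξ x - avg(Φ) h(x)| ≤ 5 C₀ (M + L) (1-η)^{⌊n/N⌋}`. [cite: MageeOhWinter2019, Thm. 10, §3.2] -/
theorem cfTwistSumR_decay_lipschitz [NeZero q] {n₀ : ℕ}
    (hprim : ∀ n ≥ n₀, ∀ ξ η : SL(2, ZMod q), ∃ w : List (A × A), w.length = n ∧ ξ * cfSigmaWord A q w = η)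
    {N : ℕ} (hN : n₀ ≤ N) (hN1 : 1 ≤ N) {Φ : SL(2, ZMod q) → ℝ → ℝ} {M L : ℝ} (hM0 : 0 ≤ M) (hL0 : 0 ≤ L)
    (hM : ∀ η, ∀ y ∈ Icc (0 : ℝ) 1, |Φ η y| ≤ M)
    (hL : ∀ η, ∀ x ∈ Icc (0 : ℝ) 1, ∀ y ∈ Icc (0 : ℝ) 1, |Φ η x - Φ η y| ≤ L * |x - y|)
    (n : ℕ) (ξ : SL(2, ZMod q)) {x : ℝ} (hx : x ∈ Icc (0 : ℝ) 1) :
    |cfTwistSumR A q n Φ ξ x - cfFibAvg A hA h2 Φ * cfHδ A hA h2 x| ≤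
      5 * ((4 : ℝ) ^ cfDimension A * (Real.exp (4 * cfDimension A + 2) * Fintype.card (SL(2, ZMod q)) +
        Real.exp (2 * cfDimension A))) * (M + L) * (1 - cfTwEta A N) ^ (n / N) := by
  have hδ := (cfDimension_pos hA h2).le
  set K := 4 * cfDimension A + 2 with hKdef
  have hK2 : (2 : ℝ) ≤ K := by rw [hKdef]; linarith
  have hK0 : 0 < K := by linarith
  set C₀ := (4 : ℝ) ^ cfDimension A * (Real.exp (4 * cfDimension A + 2) * Fintype.card (SL(2, ZMod q)) +
        Real.exp (2 * cfDimension A)) with hC₀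
  have hC₀0 : 0 ≤ C₀ := by positivity
  obtain ⟨hη0, hη4⟩ := cfTwEta_pos_le A hA h2 N
  have hρ : 0 ≤ (1 - cfTwEta A N) ^ (n / N) := pow_nonneg (by linarith) _
  -- Lipschitz fibres are continuous
  have hΦc : ∀ η, ContinuousOn (Φ η) (Icc 0 1) := fun η => by
    have hlip : LipschitzOnWith (Real.toNNReal L) (Φ η) (Icc 0 1) :=
      LipschitzOnWith.of_dist_le_mul fun x hx y hy => by
        rw [Real.dist_eq, Real.dist_eq, Real.coe_toNNReal _ hL0]; exact hL η x hx y hy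
    exact hlip.continuousOn
  rcases (add_nonneg hM0 hL0).eq_or_lt with hML | hML
  · -- `M = L = 0`: `Φ = 0` on `[0,1]`
    have hM00 : M = 0 := by linarith
    have hΦ0 : ∀ η, ∀ y ∈ Icc (0 : ℝ) 1, Φ η y = (fun (_ : SL(2, ZMod q)) (_ : ℝ) => (0 : ℝ)) η y := fun η y hy => by
      have := hM η y hy; rw [hM00] at this; exact abs_nonpos_iff.1 this
    have hT0 : cfTwistSumR A q n Φ ξ x = 0 := by
      rw [cfTwistSumR_congr A q hA hΦ0 n ξ hx]
      have h := cfTwistSumR_const_mul A (q := q) 0 n (fun _ _ => (1 : ℝ)) ξ x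
      simp only [zero_mul] at h
      exact h
    have havg0 : cfFibAvg A hA h2 Φ = 0 := by
      unfold cfFibAvg
      rw [Finset.sum_eq_zero fun η _ => ?_, mul_zero]
      rw [cfInt_congr (cfNuδ A hA h2) (hΦ0 η), cfInt_const]
    rw [hT0, havg0, ← hML]; simp
  · -- shift into the cone: `G = Φ + c`, `c = 2(M+L)`
    set c := 2 * (M + L) with hc
    have hcpos : 0 < c := by positivity
    have hcbig : M + L / K < c := by
      have : L / K ≤ L / 2 := div_le_div_of_nonneg_left hL0 two_pos hK2
      have : L / 2 ≤ L := by linarith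
      rw [hc]; linarith
    set G : SL(2, ZMod q) → ℝ → ℝ := fun η y => Φ η y + c with hG
    have hGc : ∀ η, CfCone K (G η) := fun η => CfCone.of_lipschitz hK0 hL0 hcbig (hM η) (hL η)
    have h1c : ∀ η : SL(2, ZMod q), CfCone K ((fun (_ : SL(2, ZMod q)) (_ : ℝ) => (1 : ℝ)) η) :=
      fun _ => CfCone.const one_pos hK0.le
    have hΦsplit : Φ = fun η y => G η y + (-c) * (fun (_ : SL(2, ZMod q)) (_ : ℝ) => (1 : ℝ)) η y := by
      funext η y; simp [hG]
    have hGcont : ∀ η, ContinuousOn (G η) (Icc 0 1) := fun η => (hGc η).continuousOn hK0.le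
    -- averages
    have havgΦ : cfFibAvg A hA h2 Φ = cfFibAvg A hA h2 G - c := by
      rw [hΦsplit, cfFibAvg_add_smul A hA h2 hGcont (fun _ => continuousOn_const), cfFibAvg_one A hA h2]; ring
    have havgG : cfFibAvg A hA h2 G ≤ M + c := by
      unfold cfFibAvg
      have hcard : (0 : ℝ) < Fintype.card (SL(2, ZMod q)) := by exact_mod_cast Fintype.card_pos
      have hle : ∀ η, cfInt (cfNuδ A hA h2) (G η) ≤ M + c := fun η => by
        have h := cfInt_mono (cfNuδ A hA h2) (hGcont η) continuousOn_const (g' := fun _ => M + c) fun y hy => by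
          show G η y ≤ M + c
          simp only [hG]; linarith [(abs_le.1 (hM η y hy)).2]
        rwa [cfInt_const] at h
      calc (Fintype.card (SL(2, ZMod q)) : ℝ)⁻¹ * ∑ η, cfInt (cfNuδ A hA h2) (G η)
          ≤ (Fintype.card (SL(2, ZMod q)) : ℝ)⁻¹ * ∑ _η : SL(2, ZMod q), (M + c) :=
            mul_le_mul_of_nonneg_left (Finset.sum_le_sum fun η _ => hle η) (inv_pos.2 hcard).le
        _ = M + c := by
            rw [Finset.sum_const, Finset.card_univ, nsmul_eq_mul, ← mul_assoc, inv_mul_cancel₀ hcard.ne', one_mul]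
    have havgGpos : 0 ≤ cfFibAvg A hA h2 G := by
      unfold cfFibAvg
      exact mul_nonneg (inv_nonneg.2 (by positivity))
        (Finset.sum_nonneg fun η _ => ((hGc η).cfInt_pos (cfNuδ A hA h2) hK0.le).le)
    -- decay for `G` and for `𝟙`
    have hdG := cfTwistSumR_decay_cone A hA h2 hprim hN hN1 hGc n ξ hx
    have hd1 := cfTwistSumR_decay_cone A hA h2 hprim hN hN1 h1c n ξ hx
    rw [cfFibAvg_one A hA h2, one_mul, one_mul] at hd1
    -- split `T_n Φ`
    have hT : cfTwistSumR A q n Φ ξ x = cfTwistSumR A q n G ξ x + (-c) * cfTwistSumR A q n (fun _ _ => (1 : ℝ)) ξ x := by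
      rw [hΦsplit, cfTwistSumR_add_smul]
    rw [hT, havgΦ]
    have e : cfTwistSumR A q n G ξ x + -c * cfTwistSumR A q n (fun _ _ => (1 : ℝ)) ξ x -
        (cfFibAvg A hA h2 G - c) * cfHδ A hA h2 x =
        (cfTwistSumR A q n G ξ x - cfFibAvg A hA h2 G * cfHδ A hA h2 x) -
          c * (cfTwistSumR A q n (fun _ _ => (1 : ℝ)) ξ x - cfHδ A hA h2 x) := by ring
    rw [e]
    refine (abs_sub _ _).trans ?_
    rw [abs_mul, abs_of_pos hcpos]
    have hsum : cfFibAvg A hA h2 G * (C₀ * (1 - cfTwEta A N) ^ (n / N)) + c * (C₀ * (1 - cfTwEta A N) ^ (n / N)) ≤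
        5 * C₀ * (M + L) * (1 - cfTwEta A N) ^ (n / N) := by
      have h1 : cfFibAvg A hA h2 G + c ≤ 5 * (M + L) := by rw [hc] at havgG ⊢; linarith
      have := mul_le_mul_of_nonneg_right h1 (mul_nonneg hC₀0 hρ)
      linarith [this]
    exact (add_le_add hdG (mul_le_mul_of_nonneg_left hd1 hcpos.le)).trans hsum

end Gap

end Literature.NumberTheory.Sieve
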